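import Mathlib.Analysis.SpecialFunctions.Gaussian.FourierTransform
import Mathlib.Analysis.SpecialFunctions.Pow.Real
import Mathlib.Analysis.Complex.Exponential
import Mathlib.Algebra.Order.BigOperators.Group.Finset
import Mathlib.MeasureTheory.Measure.Haar.NormedSpace
import HarnessLib

/-!
# Dimock, *Ultraviolet stability for QED in d = 3*, §4.2.2 «boson integral — large field region»: LEMMA 24's
# Gaussian step (494) «`∫dμ_I(Z̃_j)exp(Cp_{0,j}⁻¹‖Z̃_j‖²) ≤ exp(Cp_{0,j}⁻¹|Ω_{j+1} − Λ_{j+1}|)`» and LEMMA 25 (498)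
# «`Z_L(N,e) ≤ Z(N,0)e_K`» FROM (500) — the tiny factor extracted from the non-empty large-field history and the
# closing arithmetic — PROVED (the pure Gaussian on a real inner-product space; an abstract finite history sum)

statement-level skeleton of published theorems with citation tags; proofs where landed; nothing here is a claim about the Yang–Mills mass gap

**Citation header (reproduction of PUBLISHED work).** J. Dimock, *Ultraviolet stability for QED in d = 3*, Ann. Henri
Poincaré **23** (2022) 2113–2205 (= arXiv:2009.01156v2) [Dimock2022UVStabilityQED3], §4.2.2 LEMMA 24 (493) p.67 L49–60
with its proof step (494) p.67 L61–115, and LEMMA 25 (498) p.68 L31–32 with its proof (499)–(500) p.68 L33–95, of the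
held arXiv text layer `paper:arxiv-2009.01156` (`p.NN Lnn` = PDF page ∕ text-layer line).  Writer seat p11
(literature-prover-lit-balaban-p11-g25-0), YM LIT SWEEP item (c) D8 (row C08; zero weight for the YM-INPRINT tokens —
LEMMA 25 is the input `‖Z_L∕Z(N,0)‖ ≤ a` of `QED3StabilityBoundAssembly.dimock_theorem2_of_lemmas25_27`).  Mathlib only.

**The printed text (verbatim, text layer).**  p.67 L61–115 (proof of LEMMA 24): *"This factors into an integral over
`A` fields and `Z` fields. For the `Z` integral we have `∫DM_{K,Π}(Z)exp(Σ_{j=0}^{K−1}Cp_{0,j}⁻¹[‖Z̃_j‖²…]_{L^{−(K−j)}})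
= Π_{j=0}^{K−1}∫dμ_{I,(Ω_{j+1}−Λ_{j+1})^{(j)}}(Z̃_j)exp(Σ_{j=0}^{K−1}Cp_{0,j}⁻¹‖Z̃_j‖²_{(Ω_{j+1}−Λ_{j+1})^{♮(j)}})
≤ Π_{j=0}^{K−1}exp(Cp_{0,j}⁻¹|Ω^{(j)}_{j+1} − Λ^{(j)}_{j+1}|) ≤ exp(Σ_{j=1}^{K}|Λ^{(j),c}_j|)` (494) Here `Z̃_j` is on
`T⁰_{N−j}` and `(Ω_{j+1} − Λ_{j+1})^{(j)}` is a subset of `T^{−j}_{N−j}`. There are `|(Ω_{j+1} − Λ_{j+1})^{(j)}|`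
variables in the integral."*  p.68 L31–32: *"Lemma 25. For `e` sufficiently small `Z_L(N,e) ≤ Z(N,0)e_K` (498)"*.
p.68 L66–95: *"… we identify `Z(N,0) = Z_b(N,0)Z_f(N,0)` and have
`Z_L(N,e) ≤ e^{(Mr_K)⁴}Z(N,0)Σ_{Π:Λ_K=∅}exp(−Σ_{j=1}^{K}2p_{0,j}(Mr_j)⁻³(|P^{(j)}_j| + |Q^{(j)}_j| + |R^{(j)}_j| +
|U^{(j)}_j|) + CΣ_{j=1}^{K}|Λ^{(j),c}_j|)` (500) Without the condition `Λ_K ≠ ∅` this is a model independent sum over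
`{P_j,Q_j,R_j,U_j}_{j=1}^{K}` first estimated in [3] where it is bounded by a constant; see also [27]. The key point
as before is that if `p₀` is sufficiently large then the constant `p_{0,j}(Mr_j)⁻³` can be as large power of
`(−log e_K)` as we like to drive the convergence. Since the case with all the `P_j,Q_j,R_j,U_j = ∅` is excluded we
can extract a tiny factor `exp(−2p_{0,j}(Mr_j)⁻³) ≤ exp(−2p_{0,K}(Mr_K)⁻³)` from somewhere. Again assuming `p_{0,K}`
is sufficiently large, this is enough to dominate the factor `exp((Mr_K)⁴)` and any constants and still leave a
factor smaller than `e_K`. Then we have the announced `Z_L(N,e) ≤ Z(N,0)e_K`."*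

**What is formalized (kernel-checked, zero `sorry`, no named facts).**
* §1 **(494), one block of variables** — on a real inner-product space `V` of dimension `n` («there are `n` variables
  in the integral»), for `0 ≤ c < ½`: `integral_exp_mul_sq_norm_gaussian` (`∫e^{c‖v‖²}e^{−½‖v‖²}dv =
  (1 − 2c)^{−n∕2}·∫e^{−½‖v‖²}dv`, Mathlib's `∫e^{−b‖v‖²} = (π∕b)^{n∕2}`), `inv_one_sub_two_mul_le_exp`
  (`(1 − 2c)⁻¹ ≤ e^{4c}` for `0 ≤ c ≤ ¼`) and **`eq494_block`** (`∫e^{c‖v‖²}e^{−½‖v‖²}dv ≤ e^{2cn}·∫e^{−½‖v‖²}dv`,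
  i.e. `∫dμ_I(Z̃)e^{c‖Z̃‖²} ≤ e^{2c·n}` for the normalized Gaussian: the printed `exp(Cp_{0,j}⁻¹·#variables)`).
* §2 **(500) ⟹ (498), the history sum** — for a finite set `S` of histories `Π`, each with large-field counts
  `N_j(Π) ∈ ℕ` (`j ∈ J` finite; `N_j = |P_j| + |Q_j| + |R_j| + |U_j|`) NOT ALL ZERO («the case with all the
  `P_j, Q_j, R_j, U_j = ∅` is excluded»), rates `κ_j ≥ κ_min ≥ 0` (`κ_j = p_{0,j}(Mr_j)⁻³`, `κ_min = κ_K`) and any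
  real `c(Π)` (the term `CΣ|Λ^{(j),c}_j|`): `half_rate_extraction` (`Σ_j 2κ_jN_j ≥ κ_min + Σ_j κ_jN_j`),
  **`eq500_sum_le`** (`Σ_{Π∈S}exp(−Σ_j2κ_jN_j(Π) + c(Π)) ≤ e^{−κ_min}·Σ_{Π∈S}exp(−Σ_jκ_jN_j(Π) + c(Π))` — «extract a
  tiny factor … from somewhere», the remaining sum at half rate being the «model independent sum … bounded by a
  constant»), and **`lemma25_of_eq500`** ((498): `Z_L ≤ e^{m⁴}Z₀·Σ_{Π∈S}w(Π)`, the half-rate sum `≤ C₀`, and the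
  explicit largeness `κ_min ≥ m⁴ + log C₀ − log e_K` («p_{0,K} sufficiently large … dominate the factor
  `exp((Mr_K)⁴)` and any constants») ⟹ `Z_L ≤ e_K·Z₀`).

**Readings (declared).**  (i) (494) is proved for the pure Gaussian `e^{−½‖v‖²}dv` on a finite-dimensional real
inner-product space (the measure `dμ_I(Z̃_j)` of the `Z` variables is such a Gaussian); the `A`-integral half of
LEMMA 24 ((495)–(497), with its delta functions) is not reproduced.  (ii) In §2 the «model independent sum …
bounded by a constant» ([3], [27]) is the hypothesis `hC₀` at HALF the printed rate — exactly the room the printed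
extraction uses; the constant `C` of (500) rides along inside `c(Π)`.  (iii) `O(·)`∕«sufficiently large» are the
explicit inequalities named above.

**Honest scope.**  One Gaussian identity with its elementary bound, and the combinatorial skeleton of (500) ⟹ (498);
nothing about the construction of `Z_L`, the histories `Π`, (491)–(493), (495)–(497) or the bound of [3]∕[27]
itself.  No `d = 4` statement; nothing about Bałaban's papers.
**v1.1 (APPEND-ONLY; §§1–2 byte-identical; one Mathlib import added) — LEMMA 24's `A`-integral half (495)–(497) and
(493) assembled.**  The printed text, p.67 L125 – p.68 L30: *"For the `A` integral we show in appendix D that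
`Σ_{j=0}^{K−1}‖dA_j‖²_{(Λ_k−Ω_{k+1})♮} ≤ O(1)‖dA_{K,Ω}‖²` (495) by taking `p₀` sufficiently large so that we can make
`CM²p_{0,j}⁻²` as small as we like and the integral is estimated by `∫exp(−½‖A_{K,Ω}‖²)exp(Σ_{j=1}^{K}
CM²p_{0,j}⁻²‖dA_j‖²_{(Λ_j−Ω_{j+1})♮})Dm_{K,Ω}(A) ≤ ∫exp(−¼‖A_{K,Ω}‖²)Dm_{K,Ω}(A)` (496) Now `‖dA_{K,Ω}‖² =
⟨A_{K,Ω},Δ_{K,Ω}A_{K,Ω}⟩` so we can change the coefficient `¼` in (496) to `½` by a change of variables `A_{K,Ω} →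
√2A_{K,Ω}` which means `A_{j,δΩ_j} → √2A_{j,δΩ_j}` for `0 ≤ j ≤ K − 1`. If the measure `Dm_{K,Ω}(A)` had no delta
functions the change of variables would generate a factor of `√2` raised to the power `Σ_{j=0}^{K−1}|δΩ_j^{(j)}|`. The
delta functions reduce the power but the expression is still a good upper bound, as is `exp(Σ_{j=1}^{K}C|Λ_j^{(j),c}|)`.
So the `A` integral is bounded by `exp(Σ_{j=1}^{K}O(1)|Λ_j^{(j),c}|)∫exp(−½‖A_{K,Ω}‖²)Dm_{K,Ω}(A)` (497) which gives the
result."*  And p.67 L49–62: *"Lemma 24. `I_{K,Π}(A_K) ≤ exp(Σ_{j=1}^{K}C|Λ_j^{(j),c}|)∫exp(−½‖dA_{K,Ω}‖²)Dm_{K,Ω}(A)`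
(493) Proof. This factors into an integral over `A` fields and `Z` fields."*  §3 adds (theorems only):
* `eq496_pointwise` — (495) `Σ_jq_j ≤ c₁Q` with coefficients `0 ≤ a_j ≤ a`, `a·c₁ ≤ ¼` («`CM²p_{0,j}⁻²` as small as we
  like»), `Q ≥ 0` ⟹ `e^{−½Q}e^{Σ_ja_jq_j} ≤ e^{−¼Q}` (the integrand inequality of (496));
* **`eq497_scaling`** — THE CHANGE OF VARIABLES: for ANY additive Haar (Lebesgue) measure `μ` on a real vector space of
  dimension `d` and any `q` with `q(c·x) = c²q(x)`: `∫e^{−¼q}dμ = 2^{d∕2}∫e^{−½q}dμ` (Mathlib's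
  `Measure.integral_comp_smul_of_nonneg` at `R = 1∕√2`).  Reading: `Dm_{K,Ω}(A)` = Lebesgue measure on the linear
  subspace cut out by the delta functions `δ(A_{k+1} − QA_k)δ(τA_k)` of (13), `d` = its dimension («the delta functions
  reduce the power»), `q = ‖dA_{K,Ω}‖²` restricted to it;
* `integrable_exp_quarter` — `e^{−½q}` integrable ⟹ `e^{−¼q}` integrable (same change of variables);
* **`lemma24_A`** — (496) + (497): `∫e^{−½q}e^{Σ_ja_jq_j}dμ ≤ 2^{d∕2}∫e^{−½q}dμ` under (495) pointwise, the smallness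
  `a·c₁ ≤ ¼` and the integrability of `e^{−½q}` (= finiteness of the free boson integral);
* `two_rpow_half_le_exp` — `2^{d∕2} ≤ e^{S}` once `d·log 2∕2 ≤ S` (the count «`√2` raised to the power
  `Σ|δΩ_j^{(j)}|` … still a good upper bound, as is `exp(ΣC|Λ_j^{(j),c}|)`» enters as this hypothesis);
* `lemma24_assembled` — (493) from «this factors into an integral over `A` fields and `Z` fields» (`I = I_Z·I_A`, with
  `integral_prod_mul_eq` = Fubini for a product integrand on a product measure), the `Z`-half (494) `I_Z ≤ e^{S₁}` (§1,
  block by block) and the `A`-half `I_A ≤ e^{S₂}·∫e^{−½q}`: `I ≤ e^{S₁+S₂}·∫e^{−½q}`.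
Not reproduced in v1.1: (495) itself (Appendix D LEMMAS 29–30, in the tree as `QED3PlaquetteAveragingBound`) — it is
the pointwise hypothesis `h495`; the geometric count behind `d·log 2∕2 ≤ ΣC|Λ_j^{(j),c}|`.  Writer seat p11
(literature-prover-lit-balaban-p11-g26-0).
-/

noncomputable section

namespace Literature.MathematicalPhysics.QuantumFieldTheory.Dimock2011to13

namespace QED3LargeFieldPartition

open MeasureTheory Finset

/-! ## §1 (494): the Gaussian integral of `e^{c‖Z̃‖²}` over `n` variables -/

section Gaussian

variable {V : Type*} [NormedAddCommGroup V] [InnerProductSpace ℝ V] [FiniteDimensional ℝ V]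
  [MeasurableSpace V] [BorelSpace V]

/-- **(494), the identity**: for `0 ≤ c < ½` on a real inner-product space of dimension `n`,
`∫e^{c‖v‖²}e^{−½‖v‖²}dv = (1 − 2c)^{−n∕2}·∫e^{−½‖v‖²}dv` (both sides via `∫e^{−b‖v‖²}dv = (π∕b)^{n∕2}`).
[cite: Dimock2022UVStabilityQED3, §4.2.2 Lemma 24 proof (494) p.67 L93–115] -/
theorem integral_exp_mul_sq_norm_gaussian {c : ℝ} (hc : c < 1 / 2) :
    ∫ v : V, Real.exp (c * ‖v‖ ^ 2) * Real.exp (-(1 / 2) * ‖v‖ ^ 2)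
      = (1 - 2 * c) ^ (-(Module.finrank ℝ V / 2 : ℝ)) * ∫ v : V, Real.exp (-(1 / 2) * ‖v‖ ^ 2) := by
  have hb : 0 < 1 / 2 - c := by linarith
  have h1 : ∀ v : V, Real.exp (c * ‖v‖ ^ 2) * Real.exp (-(1 / 2) * ‖v‖ ^ 2)
      = Real.exp (-(1 / 2 - c) * ‖v‖ ^ 2) := by
    intro v; rw [← Real.exp_add]; ring_nf
  simp_rw [h1]
  rw [GaussianFourier.integral_rexp_neg_mul_sq_norm hb,
    GaussianFourier.integral_rexp_neg_mul_sq_norm (by norm_num : (0 : ℝ) < 1 / 2)]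
  have h12 : 0 < 1 - 2 * c := by linarith
  have hπ : Real.pi / (1 / 2 - c) = (1 - 2 * c)⁻¹ * (Real.pi / (1 / 2)) := by
    field_simp
  rw [hπ, Real.mul_rpow (inv_nonneg.mpr h12.le) (by positivity), Real.inv_rpow h12.le,
    Real.rpow_neg h12.le]

/-- `(1 − 2c)⁻¹ ≤ e^{4c}` for `0 ≤ c ≤ ¼` (since `(1 − 2c)(1 + 4c) ≥ 1` there and `1 + 4c ≤ e^{4c}`).
[cite: Dimock2022UVStabilityQED3, §4.2.2 Lemma 24 proof (494) p.67 L104–113] -/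
theorem inv_one_sub_two_mul_le_exp {c : ℝ} (hc0 : 0 ≤ c) (hc : c ≤ 1 / 4) :
    (1 - 2 * c)⁻¹ ≤ Real.exp (4 * c) := by
  have h12 : 0 < 1 - 2 * c := by linarith
  have h1 : 1 ≤ (1 - 2 * c) * (1 + 4 * c) := by nlinarith
  have h2 : 1 + 4 * c ≤ Real.exp (4 * c) := by linarith [Real.add_one_le_exp (4 * c)]
  have h3 : 1 ≤ (1 - 2 * c) * Real.exp (4 * c) := h1.trans (mul_le_mul_of_nonneg_left h2 h12.le)
  calc (1 - 2 * c)⁻¹ = (1 - 2 * c)⁻¹ * 1 := (mul_one _).symm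
    _ ≤ (1 - 2 * c)⁻¹ * ((1 - 2 * c) * Real.exp (4 * c)) :=
        mul_le_mul_of_nonneg_left h3 (inv_nonneg.mpr h12.le)
    _ = Real.exp (4 * c) := by rw [← mul_assoc, inv_mul_cancel₀ h12.ne', one_mul]

/-- **(494), one block** — «`∫dμ_I(Z̃_j)exp(Cp_{0,j}⁻¹‖Z̃_j‖²) ≤ exp(Cp_{0,j}⁻¹|Ω_{j+1} − Λ_{j+1}|)` … there are
`|(Ω_{j+1} − Λ_{j+1})^{(j)}|` variables in the integral»: for `0 ≤ c ≤ ¼` and `n = dim V` variables,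
`∫e^{c‖v‖²}e^{−½‖v‖²}dv ≤ e^{2c·n}·∫e^{−½‖v‖²}dv`. [cite: Dimock2022UVStabilityQED3, §4.2.2 Lemma 24 (494) p.67 L93–115] -/
theorem eq494_block {c : ℝ} (hc0 : 0 ≤ c) (hc : c ≤ 1 / 4) :
    ∫ v : V, Real.exp (c * ‖v‖ ^ 2) * Real.exp (-(1 / 2) * ‖v‖ ^ 2)
      ≤ Real.exp (2 * c * Module.finrank ℝ V) * ∫ v : V, Real.exp (-(1 / 2) * ‖v‖ ^ 2) := by
  rw [integral_exp_mul_sq_norm_gaussian (by linarith)]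
  have hI : 0 ≤ ∫ v : V, Real.exp (-(1 / 2) * ‖v‖ ^ 2) :=
    integral_nonneg fun v => (Real.exp_pos _).le
  refine mul_le_mul_of_nonneg_right ?_ hI
  have h12 : 0 < 1 - 2 * c := by linarith
  set n : ℕ := Module.finrank ℝ V
  -- `(1 − 2c)^{−n/2} = ((1 − 2c)⁻¹)^{n/2} ≤ (e^{4c})^{n/2} = e^{2cn}`
  have hpow : (1 - 2 * c) ^ (-(n / 2 : ℝ)) = ((1 - 2 * c)⁻¹) ^ ((n : ℝ) / 2) := by
    rw [Real.rpow_neg h12.le, ← Real.inv_rpow h12.le]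
  rw [hpow]
  calc ((1 - 2 * c)⁻¹) ^ ((n : ℝ) / 2) ≤ (Real.exp (4 * c)) ^ ((n : ℝ) / 2) :=
        Real.rpow_le_rpow (inv_nonneg.mpr h12.le) (inv_one_sub_two_mul_le_exp hc0 hc) (by positivity)
    _ = Real.exp (2 * c * n) := by
        rw [← Real.exp_mul]; congr 1; ring

end Gaussian

/-! ## §2 (500) ⟹ LEMMA 25 (498): the history sum with the empty history excluded -/

section HistorySum

variable {H J : Type*}

/-- **the extraction** «Since the case with all the `P_j,Q_j,R_j,U_j = ∅` is excluded we can extract a tiny factor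
`exp(−2p_{0,j}(Mr_j)⁻³) ≤ exp(−2p_{0,K}(Mr_K)⁻³)` from somewhere»: if the counts `N_j ∈ ℕ` are not all zero on the
finite index set `s` and `κ_min ≤ κ_j`, `0 ≤ κ_j`, then `κ_min + Σ_{j∈s}κ_jN_j ≤ Σ_{j∈s}2κ_jN_j`.
[cite: Dimock2022UVStabilityQED3, §4.2.2 Lemma 25 proof p.68 L87–93] -/
theorem half_rate_extraction (s : Finset J) (κ : J → ℝ) (N : J → ℕ) {κmin : ℝ}
    (hκ : ∀ j ∈ s, κmin ≤ κ j) (hκ0 : ∀ j ∈ s, 0 ≤ κ j) (hN : ∃ j ∈ s, 1 ≤ N j) :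
    κmin + ∑ j ∈ s, κ j * N j ≤ ∑ j ∈ s, 2 * κ j * N j := by
  obtain ⟨j₀, hj₀, hN₀⟩ := hN
  have hsplit : ∑ j ∈ s, 2 * κ j * N j = ∑ j ∈ s, κ j * N j + ∑ j ∈ s, κ j * N j := by
    rw [← Finset.sum_add_distrib]; refine Finset.sum_congr rfl fun j _ => by ring
  rw [hsplit]
  refine add_le_add (le_trans ?_ (Finset.single_le_sum (f := fun j => κ j * (N j : ℝ))
    (fun j hj => mul_nonneg (hκ0 j hj) (Nat.cast_nonneg _)) hj₀)) le_rfl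
  have h1 : (1 : ℝ) ≤ N j₀ := by exact_mod_cast hN₀
  calc κmin ≤ κ j₀ := hκ j₀ hj₀
    _ = κ j₀ * 1 := (mul_one _).symm
    _ ≤ κ j₀ * N j₀ := mul_le_mul_of_nonneg_left h1 (hκ0 j₀ hj₀)

/-- **(500), the sum**: over a finite set `S` of histories in each of which some count is `≥ 1`,
`Σ_{Π∈S}exp(−Σ_j2κ_jN_j(Π) + c(Π)) ≤ e^{−κ_min}·Σ_{Π∈S}exp(−Σ_jκ_jN_j(Π) + c(Π))` — the tiny factor times the
«model independent sum» at half the rate. [cite: Dimock2022UVStabilityQED3, §4.2.2 Lemma 25 proof (500) p.68 L66–93] -/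
theorem eq500_sum_le (S : Finset H) (s : Finset J) (κ : J → ℝ) (N : H → J → ℕ) (c : H → ℝ) {κmin : ℝ}
    (hκ : ∀ j ∈ s, κmin ≤ κ j) (hκ0 : ∀ j ∈ s, 0 ≤ κ j) (hN : ∀ X ∈ S, ∃ j ∈ s, 1 ≤ N X j) :
    ∑ X ∈ S, Real.exp (-(∑ j ∈ s, 2 * κ j * N X j) + c X)
      ≤ Real.exp (-κmin) * ∑ X ∈ S, Real.exp (-(∑ j ∈ s, κ j * N X j) + c X) := by
  rw [Finset.mul_sum]
  refine Finset.sum_le_sum fun X hX => ?_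
  rw [← Real.exp_add]
  exact Real.exp_le_exp.mpr (by linarith [half_rate_extraction s κ (N X) hκ hκ0 (hN X hX)])

/-- **LEMMA 25 (498) from (500)** — «Again assuming `p_{0,K}` is sufficiently large, this is enough to dominate the
factor `exp((Mr_K)⁴)` and any constants and still leave a factor smaller than `e_K`. Then we have the announced
`Z_L(N,e) ≤ Z(N,0)e_K`»: with (500) `Z_L ≤ e^{m⁴}·Z₀·Σ_{Π∈S}exp(−Σ_j2κ_jN_j(Π) + c(Π))` (`m = Mr_K`, `Z₀ = Z(N,0) ≥ 0`,
every history in `S` with some `N_j ≥ 1`, rates `κ_j ≥ κ_min ≥ 0`), the «model independent» bound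
`Σ_{Π∈S}exp(−Σ_jκ_jN_j(Π) + c(Π)) ≤ C₀` at half rate, and the explicit largeness `m⁴ + log C₀ − log e_K ≤ κ_min`:
`Z_L ≤ e_K·Z₀`. [cite: Dimock2022UVStabilityQED3, §4.2.2 Lemma 25 (498)–(500) p.68 L31–95] -/
theorem lemma25_of_eq500 (S : Finset H) (s : Finset J) (κ : J → ℝ) (N : H → J → ℕ) (c : H → ℝ)
    {κmin m Z₀ ZL C₀ eK : ℝ} (hκ : ∀ j ∈ s, κmin ≤ κ j) (hκ0 : ∀ j ∈ s, 0 ≤ κ j)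
    (hN : ∀ X ∈ S, ∃ j ∈ s, 1 ≤ N X j) (hZ₀ : 0 ≤ Z₀) (hC₀ : 0 < C₀) (heK : 0 < eK)
    (h500 : ZL ≤ Real.exp (m ^ 4) * Z₀ * ∑ X ∈ S, Real.exp (-(∑ j ∈ s, 2 * κ j * N X j) + c X))
    (hmodel : ∑ X ∈ S, Real.exp (-(∑ j ∈ s, κ j * N X j) + c X) ≤ C₀)
    (hlarge : m ^ 4 + Real.log C₀ - Real.log eK ≤ κmin) :
    ZL ≤ eK * Z₀ := by
  have hsum := eq500_sum_le S s κ N c hκ hκ0 hN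
  have hexp0 : 0 ≤ Real.exp (-κmin) := (Real.exp_pos _).le
  have h1 : ∑ X ∈ S, Real.exp (-(∑ j ∈ s, 2 * κ j * N X j) + c X) ≤ Real.exp (-κmin) * C₀ :=
    hsum.trans (mul_le_mul_of_nonneg_left hmodel hexp0)
  have h2 : Real.exp (m ^ 4) * (Real.exp (-κmin) * C₀) ≤ eK := by
    have hC : C₀ = Real.exp (Real.log C₀) := (Real.exp_log hC₀).symm
    calc Real.exp (m ^ 4) * (Real.exp (-κmin) * C₀)
        = Real.exp (m ^ 4 + -κmin + Real.log C₀) := by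
          rw [Real.exp_add, Real.exp_add, ← hC]; ring
      _ ≤ Real.exp (Real.log eK) := Real.exp_le_exp.mpr (by linarith)
      _ = eK := Real.exp_log heK
  calc ZL ≤ Real.exp (m ^ 4) * Z₀ * ∑ X ∈ S, Real.exp (-(∑ j ∈ s, 2 * κ j * N X j) + c X) := h500
    _ ≤ Real.exp (m ^ 4) * Z₀ * (Real.exp (-κmin) * C₀) :=
        mul_le_mul_of_nonneg_left h1 (mul_nonneg (Real.exp_pos _).le hZ₀)
    _ = (Real.exp (m ^ 4) * (Real.exp (-κmin) * C₀)) * Z₀ := by ring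
    _ ≤ eK * Z₀ := mul_le_mul_of_nonneg_right h2 hZ₀

end HistorySum

/-! ## §3 (v1.1) LEMMA 24's `A`-integral: (495) ⟹ (496), the change of variables (497), and (493) assembled -/

section AIntegral

/-- **(496), the integrand inequality**: with (495) `Σ_{j∈s}q_j ≤ c₁Q` (`q_j = ‖dA_j‖²_{(Λ_j−Ω_{j+1})♮} ≥ 0`,
`Q = ‖dA_{K,Ω}‖² ≥ 0`), coefficients `a_j ≤ a` (`a_j = CM²p_{0,j}⁻²`) and «`p₀` sufficiently large so that we can make
`CM²p_{0,j}⁻²` as small as we like» = `a·c₁ ≤ ¼`: `e^{−½Q}·e^{Σ_ja_jq_j} ≤ e^{−¼Q}`.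
[cite: Dimock2022UVStabilityQED3, §4.2.2 Lemma 24 proof (495)–(496) p.67 L125–155] -/
theorem eq496_pointwise {J : Type*} (s : Finset J) (a q : J → ℝ) {amax c₁ Q : ℝ}
    (hq0 : ∀ j ∈ s, 0 ≤ q j) (ha : ∀ j ∈ s, a j ≤ amax) (hamax : 0 ≤ amax) (hQ : 0 ≤ Q)
    (h495 : ∑ j ∈ s, q j ≤ c₁ * Q) (hsmall : amax * c₁ ≤ 1 / 4) :
    Real.exp (-(1 / 2) * Q) * Real.exp (∑ j ∈ s, a j * q j) ≤ Real.exp (-(1 / 4) * Q) := by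
  rw [← Real.exp_add]
  refine Real.exp_le_exp.mpr ?_
  have h1 : ∑ j ∈ s, a j * q j ≤ amax * ∑ j ∈ s, q j := by
    rw [Finset.mul_sum]
    exact Finset.sum_le_sum fun j hj => mul_le_mul_of_nonneg_right (ha j hj) (hq0 j hj)
  have h2 : amax * ∑ j ∈ s, q j ≤ amax * (c₁ * Q) := mul_le_mul_of_nonneg_left h495 hamax
  have h3 : amax * (c₁ * Q) ≤ 1 / 4 * Q := by
    rw [← mul_assoc]; exact mul_le_mul_of_nonneg_right hsmall hQ
  linarith

variable {E : Type*} [NormedAddCommGroup E] [NormedSpace ℝ E] [MeasurableSpace E] [BorelSpace E]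
  [FiniteDimensional ℝ E] (μ : Measure E) [Measure.IsAddHaarMeasure μ]

/-- **(497), the change of variables `A → √2A`**: for any additive Haar (Lebesgue) measure `μ` on a real vector space
`E` of dimension `d` (the constraint subspace of the delta functions; «the delta functions reduce the power») and any
`q : E → ℝ` homogeneous of degree two (`q = ⟨A,Δ_{K,Ω}A⟩` restricted to it):
`∫e^{−¼q(x)}dμ = 2^{d∕2}·∫e^{−½q(x)}dμ` — «the change of variables would generate a factor of `√2` raised to the power»
`d`. [cite: Dimock2022UVStabilityQED3, §4.2.2 Lemma 24 proof (496)–(497) p.68 L1–30] -/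
theorem eq497_scaling (q : E → ℝ) (hq : ∀ (c : ℝ) (x : E), q (c • x) = c ^ 2 * q x) :
    ∫ x, Real.exp (-(1 / 4) * q x) ∂μ
      = (2 : ℝ) ^ ((Module.finrank ℝ E : ℝ) / 2) * ∫ x, Real.exp (-(1 / 2) * q x) ∂μ := by
  set R : ℝ := (Real.sqrt 2)⁻¹ with hRdef
  have hR0 : 0 ≤ R := by positivity
  have hR2 : R ^ 2 = 1 / 2 := by
    rw [hRdef, inv_pow, Real.sq_sqrt (by norm_num : (0:ℝ) ≤ 2)]; norm_num
  have hpt : ∀ x, Real.exp (-(1 / 4) * q x) = (fun y => Real.exp (-(1 / 2) * q y)) (R • x) := by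
    intro x
    simp only [hq, hR2]
    congr 1; ring
  simp_rw [hpt]
  rw [Measure.integral_comp_smul_of_nonneg μ (fun y => Real.exp (-(1 / 2) * q y)) R (hR := hR0)]
  rw [smul_eq_mul]
  congr 1
  rw [hRdef, inv_pow, inv_inv, Real.sqrt_eq_rpow, ← Real.rpow_natCast, ← Real.rpow_mul (by norm_num : (0:ℝ) ≤ 2)]
  congr 1; ring

/-- The scaled Gaussian `e^{−¼q}` is integrable when `e^{−½q}` is (same change of variables) — the finiteness of the
free boson integral carries over to the dominating integrand of (496).
[cite: Dimock2022UVStabilityQED3, §4.2.2 Lemma 24 proof (496)–(497) p.67 L147 – p.68 L30] -/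
theorem integrable_exp_quarter (q : E → ℝ) (hq : ∀ (c : ℝ) (x : E), q (c • x) = c ^ 2 * q x)
    (hint : Integrable (fun x => Real.exp (-(1 / 2) * q x)) μ) :
    Integrable (fun x => Real.exp (-(1 / 4) * q x)) μ := by
  set R : ℝ := (Real.sqrt 2)⁻¹ with hRdef
  have hRne : R ≠ 0 := by positivity
  have hR2 : R ^ 2 = 1 / 2 := by
    rw [hRdef, inv_pow, Real.sq_sqrt (by norm_num : (0:ℝ) ≤ 2)]; norm_num
  have hpt : (fun x => Real.exp (-(1 / 4) * q x)) = fun x => (fun y => Real.exp (-(1 / 2) * q y)) (R • x) := by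
    ext x
    simp only [hq, hR2]
    congr 1; ring
  rw [hpt]
  exact hint.comp_smul hRne

/-- **LEMMA 24's `A`-integral, (496) + (497)**: on the constraint subspace `E` (dimension `d`, Lebesgue measure `μ`),
with `q ≥ 0` homogeneous of degree two, block forms `q_j ≥ 0` satisfying (495) `Σ_{j∈s}q_j(x) ≤ c₁q(x)` pointwise,
coefficients `a_j ≤ a`, `0 ≤ a`, `a·c₁ ≤ ¼`, and `e^{−½q}` integrable:
`∫e^{−½q}e^{Σ_ja_jq_j}dμ ≤ 2^{d∕2}·∫e^{−½q}dμ`.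
[cite: Dimock2022UVStabilityQED3, §4.2.2 Lemma 24 proof (495)–(497) p.67 L125 – p.68 L30] -/
theorem lemma24_A {J : Type*} (s : Finset J) (a : J → ℝ) (qj : J → E → ℝ) (q : E → ℝ) {amax c₁ : ℝ}
    (hq2 : ∀ (c : ℝ) (x : E), q (c • x) = c ^ 2 * q x) (hq0 : ∀ x, 0 ≤ q x)
    (hqj0 : ∀ j ∈ s, ∀ x, 0 ≤ qj j x) (ha : ∀ j ∈ s, a j ≤ amax) (hamax : 0 ≤ amax)
    (h495 : ∀ x, ∑ j ∈ s, qj j x ≤ c₁ * q x) (hsmall : amax * c₁ ≤ 1 / 4)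
    (hint : Integrable (fun x => Real.exp (-(1 / 2) * q x)) μ) :
    ∫ x, Real.exp (-(1 / 2) * q x) * Real.exp (∑ j ∈ s, a j * qj j x) ∂μ
      ≤ (2 : ℝ) ^ ((Module.finrank ℝ E : ℝ) / 2) * ∫ x, Real.exp (-(1 / 2) * q x) ∂μ := by
  rw [← eq497_scaling μ q hq2]
  refine integral_mono_of_nonneg (Filter.Eventually.of_forall fun x => by positivity)
    (integrable_exp_quarter μ q hq2 hint) (Filter.Eventually.of_forall fun x => ?_)
  exact eq496_pointwise s a (fun j => qj j x) (hqj0 · · x) ha hamax (hq0 x) (h495 x) hsmall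

/-- **«This factors into an integral over `A` fields and `Z` fields»** — Fubini for a product integrand on the product
of the `A`-measure and the `Z`-measure: `∫F(A)G(Z) d(μ_A × μ_Z) = (∫F dμ_A)(∫G dμ_Z)`.
[cite: Dimock2022UVStabilityQED3, §4.2.2 Lemma 24 proof p.67 L62] -/
theorem integral_prod_mul_eq {XA Z : Type*} [MeasurableSpace XA] [MeasurableSpace Z] (μA : Measure XA) (ν : Measure Z)
    [SigmaFinite μA] [SigmaFinite ν] (F : XA → ℝ) (G : Z → ℝ) :
    ∫ p : XA × Z, F p.1 * G p.2 ∂(μA.prod ν) = (∫ x, F x ∂μA) * ∫ z, G z ∂ν :=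
  integral_prod_mul F G

/-- The count: `2^{d∕2} ≤ e^{S}` as soon as `d·log 2∕2 ≤ S` («`√2` raised to the power `Σ_j|δΩ_j^{(j)}|` … is still a
good upper bound, as is `exp(Σ_jC|Λ_j^{(j),c}|)`»). [cite: Dimock2022UVStabilityQED3, §4.2.2 Lemma 24 proof (497) p.68 L8–30] -/
theorem two_rpow_half_le_exp {d S : ℝ} (h : d * Real.log 2 / 2 ≤ S) : (2 : ℝ) ^ (d / 2) ≤ Real.exp S := by
  rw [Real.rpow_def_of_pos (by norm_num : (0:ℝ) < 2)]
  exact Real.exp_le_exp.mpr (by linarith)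

/-- **LEMMA 24 (493) assembled**: the factorization `I_{K,Π} = I_Z·I_A`, the `Z`-half (494) `I_Z ≤ e^{S₁}` (§1, block
by block; `S₁ = Σ_jCp_{0,j}⁻¹|Ω_{j+1}−Λ_{j+1}| ≤ Σ_j|Λ_j^{(j),c}|`) and the `A`-half (497) `I_A ≤ e^{S₂}·G`
(`G = ∫e^{−½‖dA_{K,Ω}‖²}Dm_{K,Ω}(A) ≥ 0`, `S₂ = Σ_jO(1)|Λ_j^{(j),c}|`) give `I_{K,Π} ≤ e^{S₁+S₂}·G`.
[cite: Dimock2022UVStabilityQED3, §4.2.2 Lemma 24 (493) p.67 L49–62, proof (494)–(497) p.67 L62 – p.68 L30] -/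
theorem lemma24_assembled {I IZ IA G S₁ S₂ : ℝ} (hfac : I = IZ * IA) (hZ : IZ ≤ Real.exp S₁) (hZ0 : 0 ≤ IZ)
    (hA : IA ≤ Real.exp S₂ * G) (hG : 0 ≤ G) : I ≤ Real.exp (S₁ + S₂) * G := by
  rw [hfac, Real.exp_add, mul_assoc]
  calc IZ * IA ≤ IZ * (Real.exp S₂ * G) := mul_le_mul_of_nonneg_left hA hZ0
    _ ≤ Real.exp S₁ * (Real.exp S₂ * G) := mul_le_mul_of_nonneg_right hZ (by positivity)

end AIntegral


end QED3LargeFieldPartition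

end Literature.MathematicalPhysics.QuantumFieldTheory.Dimock2011to13
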